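/-
Copyright: cell pub-balaban-gaps (YM BLITZ Y1, track G1), seat g1-p2 GEN 11 (unit `pub-balaban-gaps-g1-p2`).  Row (D4) NODE O, MODEL level:
the FORM-currency chain CLOSED ON 66's HYPOTHESES — under EXACTLY the (3.37)-window hypotheses of `D4WalkBlockGaugeField`'s END
(`hw0`: rows ∕ cols of `X_μ(u,x) ≤ ηa₀`; `hw1`: rows ∕ cols of `X_μ(u,x) − X_μ(u,x − e_μ) ≤ η²a₁`; contours of length `≤ N_c`, `N_cη ≤ ℓ_c`) the
windows of 113 ∕ 114 ∕ 117 hold with `β = 2·letterB a₀ + (letterB a₀)²`, `β₀ = d(2a₁e^{a₀} + 4(letterB a₀)²)` and the transporter letters of 115 with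
`α_g = letterG ℓ_c a₀` (rows: 66's lemmas; columns: 122's twins), hence the per-cube conjugated coercivity of the one-scale covariant operator of
the gauge field `U = e^X` along the fine ℓ¹ weight with constants FREE OF THE SCALE — the (L) cube-level statement next to 66's k-free Cor. 3.5
END on the same objects.  HONEST FRAMING: model level; `X` and its windows are hypothesis data (print: (3.35)'s `A` on a cube); 104's GLOBAL margin
k-dependent here ((σ)); Bałaban's `Δ^{(k)}(𝐔)` NOT constructed; (D4) instance 0∕1; NOT BetaPertH, NOT continuum, NOT Clay.
-/
import Summits.QuantumFields.BalabanUV.Gaps.D4WalkBlockFormCovOpFineTorus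
import Summits.QuantumFields.BalabanUV.Gaps.D4WalkBlockAdjointWindowCol
import Summits.QuantumFields.BalabanUV.Gaps.D4WalkBlockGaugeField

/-!
# `Gaps.D4WalkBlockFormGaugeFieldTorus` — the windows of the FORM chain from 66's (3.37) hypotheses; per-cube coercivity of the gauge field's
# one-scale covariant operator with scale-free constants (cell pub-balaban-gaps, seat g1-p2 gen 11)

HONEST DEPENDENCY (cell pub-balaban, verbatim): continuum YM on T⁴ ⇐ BetaPertH ∧ nine spine estimates (0/9 proved); BetaPertH ⇐ (D1) ∧ (D4) ∧ CAP+tail.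

* §1 `window_Wp` ∕ `window_Wm` (rows AND columns of 66's defects `W^±_μ(u,x)` at most `η(2letterB a₀ + letterB a₀²)`), **`window_div`** (rows AND
  columns of `Σ_μ(W⁺_μ + W⁻_μ)(u,x)` at most `η²·d(2a₁e^{a₀} + 4letterB a₀²)`), `fibre_contour_letters_col` (columns of `R(U(Γ)) − 1`, `R(U(Γ)⁻¹) − 1`
  at most `letterG ℓ_c a₀`);
* §2 **`conjCoercive_compress_covOp_gaugeField`** — 117 under 66's hypotheses: for `a > 0`, `m² ≥ 0`, `K ≥ 1`, a fibre-saturated `S`, `0 < t` with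
  `tβγ ≤ 2` (`γ = 2(1 + e^{2|κ|η})`), every column site `j`: on the ball, `M·‖z‖² ≤ Re conjForm (compress (covOp u) S) κ (η·d₁(·, j)) z` with 117's `M`
  at `β, β₀, α_g` above.
WHAT IT IS NOT.  The gauged version (119, one `rw [covOp_gauge]` away) and 104's END; (D4) instance 0∕1; words of row (D4) UNCHANGED
(`ExistsUniformAcrossSmall 𝓣_Bałaban α Rσ₀ θ₀` + `TermDomination`, OBJECT level).

References (method only): T. Bałaban, Comm. Math. Phys. **99** (1985) 389–434 [B9], (3.8) p. 392, (3.37) p. 396, Thms 3.1–3.3 pp. 397–399, (3.42)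
p. 399, (3.50)–(3.60) pp. 400–402, Cor. 3.5 p. 407, Cor. 3.6 p. 408.
-/

noncomputable section

namespace Summit.QuantumFields.BalabanUV.Gaps.D4WalkBlockFormGaugeFieldTorus

open Metric Set Finset Complex Matrix
open scoped BigOperators Matrix ComplexConjugate
open Literature.MathematicalPhysics.QuantumFieldTheory.Balaban1983to89
open Literature.MathematicalPhysics.QuantumFieldTheory.Balaban1983to89.B5Prop11Lower (nsq)
open Literature.MathematicalPhysics.QuantumFieldTheory.Balaban1983to89.B6Prop22OneScaleTorus (T1)
open Summit.QuantumFields.BalabanUV.Beta.UnitLatticeLocalInverse (compress)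
open Summit.QuantumFields.BalabanUV.Beta.AccretiveCombesThomas (conjForm)
open Summit.QuantumFields.BalabanUV.Gaps.D4WalkBlockTransportAlgebra (conjOp rowSumNorm colSumNorm rowMass_defect_le_of_letters
  rowMass_defect_pair_le)
open Summit.QuantumFields.BalabanUV.Gaps.D4WalkBlockTransportWindows (rowMass_sum_le)
open Summit.QuantumFields.BalabanUV.Gaps.D4WalkBlockAdjointWindowCol (colMass_defect_le_of_letters colMass_defect_pair_le colMass_sum_le)
open Summit.QuantumFields.BalabanUV.Gaps.D4WalkBlockCovariantPropagator (covOp)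
open Summit.QuantumFields.BalabanUV.Gaps.D4WalkBlockCovariantBlockAveraging (PU)
open Summit.QuantumFields.BalabanUV.Gaps.D4WalkBlockGaugeField (Ub Ubi Wp Wm Ug Ugi Gc Gci letterB letterG Ub_mul_Ubi Ubi_mul_Ub bond_letters
  deriv_letters contour_letters contour_letters_col fibre_contour_letters)
open Summit.QuantumFields.BalabanUV.Gaps.D4WalkBlockFormCovOpFineTorus (conjCoercive_compress_covOp_fine)

variable {P : Params} {N : ℕ} {E : Type*} [NormedAddCommGroup E] [NormedSpace ℂ E]
variable {Xf : Fin P.d → E → Site P 0 → Matrix (Fin N) (Fin N) ℂ} {Γ : Site P 0 → List (Fin P.d × Site P 0)} {R a₀ a₁ : ℝ}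

/-! ## §1. The windows of the FORM chain from the (3.37) hypotheses -/

omit [NormedSpace ℂ E] in
/-- **the forward defect**: rows AND columns of `W⁺_μ(u,x)` at most `η(2letterB a₀ + letterB a₀²)`. -/
theorem window_Wp (ha₀ : 0 ≤ a₀)
    (hw0 : ∀ ν, ∀ u ∈ ball (0 : E) R, ∀ x a', rowSumNorm (Xf ν u x) a' ≤ P.eps * a₀ ∧ colSumNorm (Xf ν u x) a' ≤ P.eps * a₀) :
    ∀ μ, ∀ u ∈ ball (0 : E) R, ∀ x (b : Fin N × Fin N),
      ∑ b', ‖Wp P N Xf μ u x b b'‖ ≤ P.eps * (2 * letterB a₀ + letterB a₀ ^ 2) ∧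
      ∑ b', ‖Wp P N Xf μ u x b' b‖ ≤ P.eps * (2 * letterB a₀ + letterB a₀ ^ 2) := by
  intro μ u hu x b
  obtain ⟨a', b'⟩ := b
  have hb := bond_letters P N Xf ha₀ hw0 μ u hu x
  have hε1 : P.eps ≤ 1 := by
    unfold Params.eps
    exact pow_le_one₀ (inv_nonneg.2 P.cast_L_pos.le) (inv_le_one_of_one_le₀ (by exact_mod_cast P.hL.2.le))
  have hB0 : 0 ≤ letterB a₀ := by unfold letterB; positivity
  have hδ : 0 ≤ P.eps * letterB a₀ := mul_nonneg P.eps_pos.le hB0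
  have hfin : P.eps * letterB a₀ * (1 + P.eps * letterB a₀) + P.eps * letterB a₀ ≤ P.eps * (2 * letterB a₀ + letterB a₀ ^ 2) := by
    nlinarith [mul_nonneg P.eps_pos.le hB0, mul_le_of_le_one_left (mul_nonneg P.eps_pos.le hB0) hε1]
  unfold Wp
  exact ⟨(rowMass_defect_le_of_letters _ _ hδ (fun a => (hb a).1) (fun c => (hb c).2.2.2) a' b').trans hfin,
    (colMass_defect_le_of_letters _ _ hδ (fun c => (hb c).2.1) (fun a => (hb a).2.2.1) a' b').trans hfin⟩

omit [NormedSpace ℂ E] in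
/-- **the backward defect**: rows AND columns of `W⁻_μ(u,x)` at most `η(2letterB a₀ + letterB a₀²)`. -/
theorem window_Wm (ha₀ : 0 ≤ a₀)
    (hw0 : ∀ ν, ∀ u ∈ ball (0 : E) R, ∀ x a', rowSumNorm (Xf ν u x) a' ≤ P.eps * a₀ ∧ colSumNorm (Xf ν u x) a' ≤ P.eps * a₀) :
    ∀ μ, ∀ u ∈ ball (0 : E) R, ∀ x (b : Fin N × Fin N),
      ∑ b', ‖Wm P N Xf μ u x b b'‖ ≤ P.eps * (2 * letterB a₀ + letterB a₀ ^ 2) ∧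
      ∑ b', ‖Wm P N Xf μ u x b' b‖ ≤ P.eps * (2 * letterB a₀ + letterB a₀ ^ 2) := by
  intro μ u hu x b
  obtain ⟨a', b'⟩ := b
  have hb := bond_letters P N Xf ha₀ hw0 μ u hu (Site.unshift x μ)
  have hε1 : P.eps ≤ 1 := by
    unfold Params.eps
    exact pow_le_one₀ (inv_nonneg.2 P.cast_L_pos.le) (inv_le_one_of_one_le₀ (by exact_mod_cast P.hL.2.le))
  have hB0 : 0 ≤ letterB a₀ := by unfold letterB; positivity
  have hδ : 0 ≤ P.eps * letterB a₀ := mul_nonneg P.eps_pos.le hB0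
  have hfin : P.eps * letterB a₀ * (1 + P.eps * letterB a₀) + P.eps * letterB a₀ ≤ P.eps * (2 * letterB a₀ + letterB a₀ ^ 2) := by
    nlinarith [mul_nonneg P.eps_pos.le hB0, mul_le_of_le_one_left (mul_nonneg P.eps_pos.le hB0) hε1]
  unfold Wm
  exact ⟨(rowMass_defect_le_of_letters _ _ hδ (fun a => (hb a).2.2.1) (fun c => (hb c).2.1) a' b').trans hfin,
    (colMass_defect_le_of_letters _ _ hδ (fun c => (hb c).2.2.2) (fun a => (hb a).1) a' b').trans hfin⟩

omit [NormedSpace ℂ E] in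
/-- **the divergence**: rows AND columns of `Σ_μ(W⁺_μ + W⁻_μ)(u,x)` at most `η²·d(2a₁e^{a₀} + 4letterB a₀²)` — second order, from the derivative window.
[cite: Balaban1985BackgroundPropagators, (3.37) p.396, (3.54) p.401] -/
theorem window_div (ha₀ : 0 ≤ a₀) (ha₁ : 0 ≤ a₁)
    (hw0 : ∀ ν, ∀ u ∈ ball (0 : E) R, ∀ x a', rowSumNorm (Xf ν u x) a' ≤ P.eps * a₀ ∧ colSumNorm (Xf ν u x) a' ≤ P.eps * a₀)
    (hw1 : ∀ ν, ∀ u ∈ ball (0 : E) R, ∀ x a', rowSumNorm (Xf ν u x - Xf ν u (Site.unshift x ν)) a' ≤ P.eps ^ 2 * a₁ ∧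
      colSumNorm (Xf ν u x - Xf ν u (Site.unshift x ν)) a' ≤ P.eps ^ 2 * a₁) :
    ∀ u ∈ ball (0 : E) R, ∀ x (b : Fin N × Fin N),
      ∑ b', ‖(∑ μ, (Wp P N Xf μ u x + Wm P N Xf μ u x)) b b'‖ ≤ P.eps ^ 2 * ((P.d : ℝ) * (2 * (a₁ * Real.exp a₀) + 4 * letterB a₀ ^ 2)) ∧
      ∑ b', ‖(∑ μ, (Wp P N Xf μ u x + Wm P N Xf μ u x)) b' b‖ ≤ P.eps ^ 2 * ((P.d : ℝ) * (2 * (a₁ * Real.exp a₀) + 4 * letterB a₀ ^ 2)) := by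
  intro u hu x b
  obtain ⟨a', b'⟩ := b
  have hbond := bond_letters P N Xf ha₀ hw0
  have hder := deriv_letters P N Xf ha₀ ha₁ hw0 hw1
  have hB0 : 0 ≤ letterB a₀ := by unfold letterB; positivity
  have hδ : 0 ≤ P.eps * letterB a₀ := mul_nonneg P.eps_pos.le hB0
  have hrow : ∀ ν, ∑ q, ‖((Wp P N Xf ν u x) + (Wm P N Xf ν u x)) (a', b') q‖ ≤ 2 * (P.eps ^ 2 * (a₁ * Real.exp a₀)) + 4 * (P.eps * letterB a₀) ^ 2 :=
    fun ν => rowMass_defect_pair_le _ _ _ _ (Ub_mul_Ubi P N Xf ν u x) (Ubi_mul_Ub P N Xf ν u _) hδ (fun a => (hbond ν u hu x a).1)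
      (fun c => (hbond ν u hu x c).2.1) (fun c => (hbond ν u hu x c).2.2.2) (fun a => (hbond ν u hu _ a).1)
      (fun c => (hbond ν u hu _ c).2.1) (fun a => (hbond ν u hu _ a).2.2.1) (fun a => (hder ν u hu x a).1) (fun c => (hder ν u hu x c).2) a' b'
  have hcol : ∀ ν, ∑ p, ‖((Wp P N Xf ν u x) + (Wm P N Xf ν u x)) p (a', b')‖ ≤ 2 * (P.eps ^ 2 * (a₁ * Real.exp a₀)) + 4 * (P.eps * letterB a₀) ^ 2 :=
    fun ν => colMass_defect_pair_le _ _ _ _ (Ub_mul_Ubi P N Xf ν u x) (Ubi_mul_Ub P N Xf ν u _) hδ (fun a => (hbond ν u hu x a).1)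
      (fun c => (hbond ν u hu x c).2.1) (fun a => (hbond ν u hu x a).2.2.1) (fun a => (hbond ν u hu _ a).1)
      (fun c => (hbond ν u hu _ c).2.1) (fun c => (hbond ν u hu _ c).2.2.2) (fun a => (hder ν u hu x a).1) (fun c => (hder ν u hu x c).2) a' b'
  have hsum : ∑ _ν : Fin P.d, (2 * (P.eps ^ 2 * (a₁ * Real.exp a₀)) + 4 * (P.eps * letterB a₀) ^ 2)
      = P.eps ^ 2 * ((P.d : ℝ) * (2 * (a₁ * Real.exp a₀) + 4 * letterB a₀ ^ 2)) := by
    rw [Finset.sum_const, Finset.card_univ, Fintype.card_fin, nsmul_eq_mul]; ring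
  unfold Wp Wm at hrow hcol ⊢
  refine ⟨?_, ?_⟩
  · exact ((rowMass_sum_le _ _ _).trans (Finset.sum_le_sum fun ν _ => hrow ν)).trans (le_of_eq hsum)
  · exact ((colMass_sum_le _ _ _).trans (Finset.sum_le_sum fun ν _ => hcol ν)).trans (le_of_eq hsum)

omit [NormedSpace ℂ E] in
/-- **fibre contour letters, columns**: columns of `R(U(Γ)) − 1` and of `R(U(Γ)⁻¹) − 1` at most `letterG ℓ_c a₀` (66's row version + 122). -/
theorem fibre_contour_letters_col {Nc : ℕ} {ℓ : ℝ} (ha₀ : 0 ≤ a₀) (hΓ : ∀ x, (Γ x).length ≤ Nc) (hNc : (Nc : ℝ) * P.eps ≤ ℓ) (hℓ : 0 ≤ ℓ)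
    (hw0 : ∀ ν, ∀ u ∈ ball (0 : E) R, ∀ x a', rowSumNorm (Xf ν u x) a' ≤ P.eps * a₀ ∧ colSumNorm (Xf ν u x) a' ≤ P.eps * a₀) :
    ∀ u ∈ ball (0 : E) R, ∀ x (q : Fin N × Fin N),
      ∑ p, ‖(Gc P N Xf Γ u x - 1) p q‖ ≤ letterG ℓ a₀ ∧ ∑ p, ‖(Gci P N Xf Γ u x - 1) p q‖ ≤ letterG ℓ a₀ := by
  intro u hu x q
  obtain ⟨q1, q2⟩ := q
  have hr := contour_letters P N Xf Γ ha₀ hΓ hNc hw0 u hu x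
  have hc := contour_letters_col P N Xf Γ ha₀ hΓ hNc hw0 u hu x
  have hδ : 0 ≤ Real.exp (ℓ * letterB a₀) - 1 := by
    have : 0 ≤ ℓ * letterB a₀ := mul_nonneg hℓ (by unfold letterB; positivity)
    linarith [Real.add_one_le_exp (ℓ * letterB a₀)]
  have e : ∀ δ : ℝ, δ * (1 + δ) + δ = 2 * δ + δ ^ 2 := fun δ => by ring
  refine ⟨?_, ?_⟩
  · unfold Gc
    calc _ ≤ _ := colMass_defect_le_of_letters _ _ hδ (fun c => (hc c).1) (fun a => (hr a).2) q1 q2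
      _ = letterG ℓ a₀ := by rw [letterG, e]
  · unfold Gci
    calc _ ≤ _ := colMass_defect_le_of_letters _ _ hδ (fun c => (hc c).2) (fun a => (hr a).1) q1 q2
      _ = letterG ℓ a₀ := by rw [letterG, e]

/-! ## §2. Per-cube coercivity of the gauge field's one-scale covariant operator, constants free of the scale -/

omit [NormedSpace ℂ E] in
/-- **PER-CUBE CONJUGATED COERCIVITY OF `Δ_U + m² + a_KP_K(U)` FOR THE GAUGE FIELD `U = e^X` UNDER THE (3.37) WINDOWS, SCALE-FREE CONSTANTS** —
117's `conjCoercive_compress_covOp_fine` with 66's defects `W^±`, fibre transporters `R(U(Γ))`, `R(U(Γ)⁻¹)` and the windows of §1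
(`β = 2letterB a₀ + letterB a₀²`, `β₀ = d(2a₁e^{a₀} + 4letterB a₀²)`, `α_g = letterG ℓ_c a₀`). [cite: Balaban1985BackgroundPropagators, (3.37) p.396, Thms 3.1–3.3 p.399, (3.50)–(3.60) pp.400–402, Cor. 3.5 p.407, Cor. 3.6 p.408] -/
theorem conjCoercive_compress_covOp_gaugeField {a msq : ℝ} (ha : 0 < a) (hmsq : 0 ≤ msq) (hK : 1 ≤ P.K) {Nc : ℕ} {ℓ : ℝ}
    (ha₀ : 0 ≤ a₀) (ha₁ : 0 ≤ a₁) (hΓ : ∀ x, (Γ x).length ≤ Nc) (hNc : (Nc : ℝ) * P.eps ≤ ℓ) (hℓ : 0 ≤ ℓ)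
    (hw0 : ∀ ν, ∀ u ∈ ball (0 : E) R, ∀ x a', rowSumNorm (Xf ν u x) a' ≤ P.eps * a₀ ∧ colSumNorm (Xf ν u x) a' ≤ P.eps * a₀)
    (hw1 : ∀ ν, ∀ u ∈ ball (0 : E) R, ∀ x a', rowSumNorm (Xf ν u x - Xf ν u (Site.unshift x ν)) a' ≤ P.eps ^ 2 * a₁ ∧
      colSumNorm (Xf ν u x - Xf ν u (Site.unshift x ν)) a' ≤ P.eps ^ 2 * a₁)
    (S : Finset (Site P 0 × (Fin N × Fin N))) (hS : ∀ p ∈ S, ∀ b : Fin N × Fin N, (p.1, b) ∈ S) {t : ℝ} (κ : ℝ) (ht : 0 < t)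
    (htγ : t * (2 * letterB a₀ + letterB a₀ ^ 2) * ((1 + Real.exp (2 * (|κ| * P.eps))) * 2) ≤ 2) (j : Site P 0) :
    ∀ u ∈ ball (0 : E) R, ∀ z : S → ℂ,
      ((1 - t * (2 * letterB a₀ + letterB a₀ ^ 2) * ((1 + Real.exp (2 * (|κ| * P.eps))) * 2) / 2)
          * (min 8 (a * (1 - (((P.L : ℝ)) ^ 2)⁻¹)) - (0 + 2 * P.d * (P.eps⁻¹ ^ 2 * (Real.cosh (|κ| * P.eps) - 1))
              + B1RG242Torus.α P a P.K * (Real.cosh (|κ| * (2 * P.d)) - 1)))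
        - (((P.d : ℝ) * (2 * (a₁ * Real.exp a₀) + 4 * letterB a₀ ^ 2)
              + B1RG242Torus.α P a P.K * (Real.exp (|κ| * (2 * P.d)) * (2 * letterG ℓ a₀ + letterG ℓ a₀ ^ 2)))
            + ((P.d : ℝ) * (2 * (a₁ * Real.exp a₀) + 4 * letterB a₀ ^ 2)
              + B1RG242Torus.α P a P.K * (Real.exp (|κ| * (2 * P.d)) * (2 * letterG ℓ a₀ + letterG ℓ a₀ ^ 2)))) / 2
        - (∑ _ι : Fin P.d ⊕ Fin P.d, (2 * letterB a₀ + letterB a₀ ^ 2)) / (2 * t)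
        - t * (2 * letterB a₀ + letterB a₀ ^ 2) * ((1 + Real.exp (2 * (|κ| * P.eps)))
            * (2 * (B1RG242Torus.α P a P.K * Real.exp (|κ| * (2 * P.d))) + 4 * P.d * (P.eps⁻¹ * (Real.exp (|κ| * P.eps) - 1)) ^ 2)) / 2)
        * nsq z
      ≤ (conjForm (compress (covOp P (Fin N × Fin N) (Wp P N Xf) (Wm P N Xf) (PU P (Fin N × Fin N) (Gc P N Xf Γ) (Gci P N Xf Γ)) a msq u) S) κ
          (fun e : S => P.eps * T1 P 0 (e : Site P 0 × (Fin N × Fin N)).1 j) z).re := by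
  have hB0 : 0 ≤ letterB a₀ := by unfold letterB; positivity
  have hG0 : 0 ≤ letterG ℓ a₀ := by
    have : 0 ≤ Real.exp (ℓ * letterB a₀) - 1 := by
      have : 0 ≤ ℓ * letterB a₀ := mul_nonneg hℓ hB0
      linarith [Real.add_one_le_exp (ℓ * letterB a₀)]
    unfold letterG; positivity
  have hrG := fibre_contour_letters P N Xf Γ ha₀ hΓ hNc hℓ hw0
  have hcG := fibre_contour_letters_col (P := P) (N := N) (Xf := Xf) (Γ := Γ) ha₀ hΓ hNc hℓ hw0
  exact conjCoercive_compress_covOp_fine ha hmsq hK S hS κ (window_Wp ha₀ hw0) (window_Wm ha₀ hw0) (window_div ha₀ ha₁ hw0 hw1) hG0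
    (fun u hu x c => ⟨(hrG u hu x c).1, (hcG u hu x c).1⟩) (fun u hu x c => ⟨(hrG u hu x c).2, (hcG u hu x c).2⟩) (by positivity) ht htγ j

end Summit.QuantumFields.BalabanUV.Gaps.D4WalkBlockFormGaugeFieldTorus

end
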